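/-
Copyright (c) 2026 the pub-hodgecm-mathlib formalisation cell (harness21).  Prover seat hodgecm-mathlib-LH7-p08 (g0) (re-dealt to strike line L3 `stub_N6nsDyadic` by director
s1969 (a)), Track A «(D-RAM) FOUR-FRAME» squad, helper lane on h413 = stmt-HodgeConjecture-24833 (count-neutral).  β-BOARD v1 row R8 ∕ (P5) «H `(2ρ,2ρ,2ρ)`», FILE 5b′: the three
WINDOWS of the character `θ = ω(G)·ω(L♭)` on `S_F` of a core-hanging lattice — when `ω_i·θ ≡ 1` on `S_F`, and witnesses `u_t` when not.  2026-09-04.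
-/
import Summits.HodgeConjecture.HodgeConjecture.Theorems.F0P3cDyRamLabelledOddCoreHangingCharacterRead   -- (this seat, FILE 5b): `v_letters_…`, `exists_mem_fixedUnitStabilizer_updown`, `v_reduced_eq`; brings ★ κH-A2, ★ ω-toolkit
import HarnessLib

/-!
# Crux `H413`, line LH4 «(D-RAM) FOUR-FRAME» — (β) table, β-BOARD row R8 ∕ (P5), FILE 5b′: «THE WINDOWS OF `θ`» — on `S_F` of a core-hanging lattice,
# `[ω₂·θ ≡ 1] ⟺ |ϖ|^ρ·|g_β − g_α| ≤ |ϖ|^{2d−1}·|G|`, `[ω₁·θ ≡ 1] = [ω₀·θ ≡ 1] = [2d − 1 ≤ ρ]`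

Cell `hodgecm-mathlib` (D-0151), FLOOR 0, crux item H413 = `stmt-HodgeConjecture-24833`, route `HCCMUnconditional`; squad F0∕P3c∕LH4.  THEOREMS ONLY (no `def`, no instance, no
notation, no `sorry`, default heartbeats); ★-only imports; lane `--supports stmt-HodgeConjecture-24833 --as helper` (count-neutral); pays NO row, states NO law.

THE MATHEMATICS (this seat's MATH NOTE 2026-09-04 21:33Z).  `θ(u) = ω(G)·ω(L♭(u))`, `L♭(u) = (1+f)g_α·u₂ + (g_β − g_α)·u₁ = u₂·G + (g_β − g_α)(u₁ − u₂)`, `G = f·g_α + g_β`, on `S_F` of the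
core-hanging member `latt V` (FILE 5b).  FILE 5a's bracket `[ω_i·θ ≡ 1 on S_F]` is evaluated slot by slot:
* §1 NEAR REGIME `|ϖ|^ρ·|g_β − g_α| ≤ |ϖ|^{2d−1}·|G|` (deep and boundary keys; the shallow key `s_g` iff `ρ + s_g ≥ 2d − 1`): `ω(L♭(u)) = ω(u₂)·ω(G)`, so `ω₂·θ ≡ 1`, and `ω₁·θ`, `ω₀·θ`
  are ★ κH-A2's pair characters `ω₁ω₂`, `ω₀ω₂`: `≡ 1` in the alive window `2d − 1 ≤ ρ`.
* §2 WITNESSES (the break non-norm `c′ ≡ 1 (mod 𝔭^{2d−2})` of ★ toolkit §2 and FILE 5b's `u_t = (1 + t∕f, 1 − t, 1) ∈ S_F`): FAR REGIME `|ϖ|^{2d−2}|G| ≤ |ϖ|^ρ|g_β − g_α|` ⇒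
  `t = (1 − c′)G∕(g_β − g_α)` gives `ω₂·θ(u_t) = ω(c′) = −1`; DEAD WINDOW `ρ ≤ 2d − 2` ⇒ `t = (1 − c′)G∕(G + g_β − g_α)` gives `ω₁·θ(u_t) = −1` and `t = (c′ − 1)Gf∕(G − f(g_β − g_α))`
  gives `ω₀·θ(u_t) = −1` (the two unit hypotheses `|G + (g_β − g_α)| = |G|`, `|G − f(g_β − g_α)| = |G|` hold for the keys of record, `|2| < 1`).
So the per-lattice labelled-odd value of FILE 5a on the core-hanging stratum is `w∕2·ω(D_i)·ω(G)·(ι, ι, J)_i`, `ι = [2d−1 ≤ ρ]`, `J = [ρ + s_g ≥ 2d−1]` — in the SHALLOW FAR case all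
three brackets vanish (the per-lattice value is `0`), which is the case the ★ collapsed reads (FILEs 3a∕4a) do not reach.
HONEST LABEL.  Count-neutral (`--supports`); the shallow H row `hZ₃` (FILE 5d), `hRest`, (T3), (β-BAL), (β), T₊ stay OPEN; `HC_CM` is proved only modulo the 7 printed citations (2 remaining
named inputs: hLiu418 = `stmt-HodgeConjecture-24832`, h413 = `stmt-HodgeConjecture-24833`) until rung 0 closes.

## References
* [Kottwitz1986BaseChangeUnits] R. E. Kottwitz, *Base change for unit elements of Hecke algebras*, Compositio Math. 60 (1986), §1 pp. 240–241 (signed lattice counts modulo the torus).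
* [LanglandsShelstad1987] R. P. Langlands, D. Shelstad, *On the definition of transfer factors*, Math. Ann. 278 (1987), §3.
* [Serre1979] J.-P. Serre, *Local Fields*, GTM 67 (1979), Ch. V §3 Prop. 5, Cor. 2–3 pp. 84–86; Ch. XV §2 (the conductor of the quadratic character).
-/

set_option autoImplicit false

noncomputable section

namespace Summit.HodgeConjecture.HodgeConjecture.Cruxes.H413.F0P3cDyRamLabelledOddCoreHangingCharacterWindows

open Matrix WithZero
open Literature.NumberTheory.Automorphic Literature.NumberTheory.Automorphic.HermitianLattice Literature.NumberTheory.Automorphic.UnitaryGroup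
open Literature.NumberTheory.Automorphic.UnitaryLatticeTree Literature.NumberTheory.Automorphic.UnitaryThreeFourFrame
open Literature.NumberTheory.LocalFields Literature.NumberTheory.LocalFields.WildQuadraticDatum
open Summit.HodgeConjecture.HodgeConjecture.Cruxes.H413.F0P3cDyRamFourFramePieces
open Summit.HodgeConjecture.HodgeConjecture.Cruxes.H413.F0P3cDyRamDiagonalTorusDefs
open Summit.HodgeConjecture.HodgeConjecture.Cruxes.H413.F0P3cDyRamDiagonalKappaCoreHangingClass (chiVec_apply chiVec_eq_one_of_mem_fixedUnitStabilizer_of_le two_le_d_of_v_two_lt_one)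
open Summit.HodgeConjecture.HodgeConjecture.Cruxes.H413.F0P3cDyRamLabelledOddCoreHangingCharacterRead
open scoped Valued WithZero Matrix MatrixGroups

variable {K : Type} [Field K] [Valued K ℤᵐ⁰]

/-! ## §1  The near regime: `ω(L♭(u)) = ω(u₂)·ω(G)`; the three brackets in the alive window -/

section Near

variable [CompleteSpace K] [Finite 𝓀[K]] {σ : K →+* K} {ϖ : K} {d t : ℕ}

/-- **NEAR REGIME: `ω(L♭(u)) = ω(u₂)·ω(G)` on `S_F`** when `|ϖ|^ρ·|g_β − g_α| ≤ |ϖ|^{2d−1}·|G|` (`L♭(u) = u₂G·(1 + (g_β−g_α)(u₁−u₂)∕(u₂G))`, ★ toolkit §3–§4).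
[cite: Serre1979, Ch. XV §2] [cite: Kottwitz1986BaseChangeUnits, §1 pp. 240–241] -/
theorem normSign_reduced_eq_of_near (hD : IsRamifiedQuadraticDatum σ ϖ d t)
    {ρ : ℕ} {x ζ f : K} (hx : Valued.v x = 1) (hζ : Valued.v ζ = 1) (hσf : σ f = f) (hf : Valued.v f = 1)
    (V : GL (Fin 3) K) (hV : (V : Matrix (Fin 3) (Fin 3) K) = !![1, 0, 0; x, ϖ ^ ρ, 0; x * ζ + f * (x * ζ), ϖ ^ ρ * ζ, ϖ ^ (2 * ρ)])
    {gα gβ : K} (hσgα : σ gα = gα) (hσgβ : σ gβ = gβ) (hG0 : f * gα + gβ ≠ 0)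
    (hnear : Valued.v ϖ ^ ρ * Valued.v (gβ - gα) ≤ Valued.v ϖ ^ (2 * d - 1) * Valued.v (f * gα + gβ))
    {u : Fin 3 → Kˣ} (hu : u ∈ fixedUnitStabilizer σ (latt (V : Matrix (Fin 3) (Fin 3) K))) :
    normSign σ ((1 + f) * gα * ((u 2 : Kˣ) : K) + (gβ - gα) * ((u 1 : Kˣ) : K)) = normSign σ ((u 2 : Kˣ) : K) * normSign σ (f * gα + gβ) := by
  obtain ⟨hσ, hvσ, hϖ, hfix, hdd, hd1, -⟩ := id hD
  have hϖ0 : ϖ ≠ 0 := fun h => by rw [h, map_zero] at hϖ; exact (exp_ne_zero hϖ.symm).elim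
  have hϖ1 : Valued.v ϖ < 1 := by rw [hϖ, ← exp_zero, exp_lt_exp]; norm_num
  have hufix : ∀ j, σ ((u j : Kˣ) : K) = u j := fun j => ((mem_fixedUnitTorus_iff σ u).1 hu.2).2 j
  have huv : ∀ j, Valued.v ((u j : Kˣ) : K) = 1 := fun j => ((mem_fixedUnitTorus_iff σ u).1 hu.2).1 j
  obtain ⟨h10, -⟩ := v_letters_of_mem_fixedUnitStabilizer hϖ0 hϖ1.le hx hζ hf V hV hu
  have hσG : σ (f * gα + gβ) = f * gα + gβ := by rw [map_add, map_mul, hσf, hσgα, hσgβ]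
  have hu20 : ((u 2 : Kˣ) : K) ≠ 0 := (u 2).ne_zero
  have hB0 : ((u 2 : Kˣ) : K) * (f * gα + gβ) ≠ 0 := mul_ne_zero hu20 hG0
  have hvB : 0 < Valued.v (((u 2 : Kˣ) : K) * (f * gα + gβ)) := (Valuation.pos_iff _).2 hB0
  -- `L♭ = (u₂G)·y`, `|y − 1| ≤ |ϖ|^{2d−1}`
  obtain ⟨y, hy⟩ : ∃ y : K, y = ((1 + f) * gα * ((u 2 : Kˣ) : K) + (gβ - gα) * ((u 1 : Kˣ) : K)) / (((u 2 : Kˣ) : K) * (f * gα + gβ)) := ⟨_, rfl⟩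
  have hσy : σ y = y := by
    rw [hy]; simp only [map_div₀, map_add, map_mul, map_sub, map_one, hσf, hσgα, hσgβ, hufix]
  have hy1 : Valued.v (y - 1) ≤ Valued.v ϖ ^ (2 * d - 1) := by
    have e : y - 1 = (gβ - gα) * (((u 1 : Kˣ) : K) - u 2) / (((u 2 : Kˣ) : K) * (f * gα + gβ)) := by
      rw [hy, div_sub_one hB0]; congr 1; ring
    rw [e, map_div₀, div_le_iff₀ hvB, map_mul, map_mul, huv 2, one_mul, Valuation.map_sub_swap _ (((u 1 : Kˣ) : K)), mul_comm]
    exact (mul_le_mul' h10 le_rfl).trans hnear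
  have e : (1 + f) * gα * ((u 2 : Kˣ) : K) + (gβ - gα) * ((u 1 : Kˣ) : K) = (((u 2 : Kˣ) : K) * (f * gα + gβ)) * y := by rw [hy, mul_div_cancel₀ _ hB0]
  rw [e, normSign_mul_eq_of_fixed_of_v_sub_one_le hD _ hσy le_rfl hy1, normSign_mul_of_fixed hD (hufix 2) hσG hu20 hG0]

/-- **SLOT 2, NEAR REGIME: `ω(u₂)·θ(u) = 1` on `S_F`** (`θ = ω(G)·ω(L♭)`; `ω(u₂)², ω(G)² = 1`). [cite: Kottwitz1986BaseChangeUnits, §1 pp. 240–241] [cite: LanglandsShelstad1987, §3] -/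
theorem forall_normSign_two_mul_theta_eq_one (hD : IsRamifiedQuadraticDatum σ ϖ d t)
    {ρ : ℕ} {x ζ f : K} (hx : Valued.v x = 1) (hζ : Valued.v ζ = 1) (hσf : σ f = f) (hf : Valued.v f = 1)
    (V : GL (Fin 3) K) (hV : (V : Matrix (Fin 3) (Fin 3) K) = !![1, 0, 0; x, ϖ ^ ρ, 0; x * ζ + f * (x * ζ), ϖ ^ ρ * ζ, ϖ ^ (2 * ρ)])
    {gα gβ : K} (hσgα : σ gα = gα) (hσgβ : σ gβ = gβ) (hG0 : f * gα + gβ ≠ 0)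
    (hnear : Valued.v ϖ ^ ρ * Valued.v (gβ - gα) ≤ Valued.v ϖ ^ (2 * d - 1) * Valued.v (f * gα + gβ)) :
    ∀ u ∈ fixedUnitStabilizer σ (latt (V : Matrix (Fin 3) (Fin 3) K)),
      normSign σ ((u 2 : Kˣ) : K) * (normSign σ (f * gα + gβ) * normSign σ ((1 + f) * gα * ((u 2 : Kˣ) : K) + (gβ - gα) * ((u 1 : Kˣ) : K))) = 1 := by
  intro u hu
  rw [normSign_reduced_eq_of_near hD hx hζ hσf hf V hV hσgα hσgβ hG0 hnear hu]
  have h2 := F0P3cDyRamDiagonalKappaSplitCountEval.normSign_mul_self σ ((u 2 : Kˣ) : K)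
  have hG := F0P3cDyRamDiagonalKappaSplitCountEval.normSign_mul_self σ (f * gα + gβ)
  linear_combination (normSign σ (f * gα + gβ) * normSign σ (f * gα + gβ)) * h2 + hG

/-- **SLOTS 1 AND 0, ALIVE WINDOW `2d − 1 ≤ ρ`: `ω(u₁)·θ(u) = 1` and `ω(u₀)·θ(u) = 1` on `S_F`** (near regime is automatic; `θ(u) = ω(u₂)`, and ★ κH-A2's pair characters are `≡ 1`).
[cite: Kottwitz1986BaseChangeUnits, §1 pp. 240–241] [cite: Serre1979, Ch. XV §2] -/
theorem forall_normSign_mul_theta_eq_one_of_le (hD : IsRamifiedQuadraticDatum σ ϖ d t)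
    {ρ : ℕ} (hal : 2 * d - 1 ≤ ρ) {x ζ f : K} (hx : Valued.v x = 1) (hζ : Valued.v ζ = 1) (hσf : σ f = f) (hf : Valued.v f = 1)
    (V : GL (Fin 3) K) (hV : (V : Matrix (Fin 3) (Fin 3) K) = !![1, 0, 0; x, ϖ ^ ρ, 0; x * ζ + f * (x * ζ), ϖ ^ ρ * ζ, ϖ ^ (2 * ρ)])
    {gα gβ : K} (hσgα : σ gα = gα) (hσgβ : σ gβ = gβ) (hG0 : f * gα + gβ ≠ 0) (hb : Valued.v (gβ - gα) ≤ Valued.v (f * gα + gβ))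
    (k : Fin 3) (hk : k = 0 ∨ k = 1) :
    ∀ u ∈ fixedUnitStabilizer σ (latt (V : Matrix (Fin 3) (Fin 3) K)),
      normSign σ ((u k : Kˣ) : K) * (normSign σ (f * gα + gβ) * normSign σ ((1 + f) * gα * ((u 2 : Kˣ) : K) + (gβ - gα) * ((u 1 : Kˣ) : K))) = 1 := by
  obtain ⟨hσ, hvσ, hϖ, hfix, hdd, hd1, -⟩ := id hD
  have hϖ1 : Valued.v ϖ < 1 := by rw [hϖ, ← exp_zero, exp_lt_exp]; norm_num
  have hnear : Valued.v ϖ ^ ρ * Valued.v (gβ - gα) ≤ Valued.v ϖ ^ (2 * d - 1) * Valued.v (f * gα + gβ) :=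
    mul_le_mul' (pow_le_pow_right_of_le_one' hϖ1.le hal) hb
  have hV0 : (V : Matrix (Fin 3) (Fin 3) K) = !![1, 0, 0; x, ϖ ^ ρ, 0; x * ζ + f * (x * ζ), ϖ ^ ρ * ζ, ϖ ^ (2 * ρ + 0)] := by rw [Nat.add_zero]; exact hV
  intro u hu
  rw [normSign_reduced_eq_of_near hD hx hζ hσf hf V hV hσgα hσgβ hG0 hnear hu]
  have hG := F0P3cDyRamDiagonalKappaSplitCountEval.normSign_mul_self σ (f * gα + gβ)
  -- ★ κH-A2: the pair character `ω_k·ω_2 ≡ 1` in the alive window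
  have hpair : normSign σ ((u k : Kˣ) : K) * normSign σ ((u 2 : Kˣ) : K) = 1 := by
    rcases hk with rfl | rfl
    · have h := chiVec_eq_one_of_mem_fixedUnitStabilizer_of_le hD ρ hx hζ hf V hV0 hal hu 1
      rw [chiVec_apply] at h; simpa using h
    · have h := chiVec_eq_one_of_mem_fixedUnitStabilizer_of_le hD ρ hx hζ hf V hV0 hal hu 0
      rw [chiVec_apply] at h; simpa using h
  linear_combination (normSign σ (f * gα + gβ) * normSign σ (f * gα + gβ)) * hpair + hG

end Near

/-! ## §2  The witnesses: `u_t ∈ S_F` with `ω_i·θ(u_t) = −1` outside the windows -/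

section Witness

variable [CompleteSpace K] [Finite 𝓀[K]] {σ : K →+* K} {ϖ : K} {d t : ℕ}

/-- **SLOT 2, FAR REGIME `|ϖ|^{2d−2}·|G| ≤ |ϖ|^ρ·|g_β − g_α|`: some `u ∈ S_F` has `ω(u₂)·θ(u) = −1`** — `u = u_t`, `t = (1 − c′)·G∕(g_β − g_α)` for the break non-norm `c′` of ★ toolkit §2
(`|t| ≤ |ϖ|^ρ`; `L♭(u_t) = G − (g_β − g_α)t = G·c′`). [cite: Serre1979, Ch. V §3 Prop. 5, Cor. 2–3 pp. 84–86; Ch. XV §2] [cite: Kottwitz1986BaseChangeUnits, §1 pp. 240–241] -/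
theorem exists_normSign_two_mul_theta_eq_neg_one (hD : IsRamifiedQuadraticDatum σ ϖ d t) (h2 : Valued.v (2 : K) < 1)
    {ρ : ℕ} (hρ : 1 ≤ ρ) {x ζ f : K} (hx : Valued.v x = 1) (hζ : Valued.v ζ = 1) (hσf : σ f = f) (hf : Valued.v f = 1)
    (V : GL (Fin 3) K) (hV : (V : Matrix (Fin 3) (Fin 3) K) = !![1, 0, 0; x, ϖ ^ ρ, 0; x * ζ + f * (x * ζ), ϖ ^ ρ * ζ, ϖ ^ (2 * ρ)])
    {gα gβ : K} (hσgα : σ gα = gα) (hσgβ : σ gβ = gβ) (hG0 : f * gα + gβ ≠ 0)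
    (hfar : Valued.v ϖ ^ (2 * d - 2) * Valued.v (f * gα + gβ) ≤ Valued.v ϖ ^ ρ * Valued.v (gβ - gα)) :
    ∃ u ∈ fixedUnitStabilizer σ (latt (V : Matrix (Fin 3) (Fin 3) K)),
      normSign σ ((u 2 : Kˣ) : K) * (normSign σ (f * gα + gβ) * normSign σ ((1 + f) * gα * ((u 2 : Kˣ) : K) + (gβ - gα) * ((u 1 : Kˣ) : K))) = -1 := by
  obtain ⟨hσ, hvσ, hϖ, hfix, hdd, hd1, -⟩ := id hD
  have hϖ0 : ϖ ≠ 0 := fun h => by rw [h, map_zero] at hϖ; exact (exp_ne_zero hϖ.symm).elim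
  have hvϖ0 : 0 < Valued.v ϖ := (Valuation.pos_iff _).2 hϖ0
  have hvG : 0 < Valued.v (f * gα + gβ) := (Valuation.pos_iff _).2 hG0
  -- the break non-norm
  obtain ⟨c', hσc', hc'1, hc'd, hc'n⟩ := exists_fixed_unit_not_norm_v_sub_one_le hD h2
  have hcd' : Valued.v (1 - c') ≤ Valued.v ϖ ^ (2 * d - 2) := by
    rw [← neg_sub, Valuation.map_neg, v_varpi_pow hϖ]; refine hc'd.trans (le_of_eq ?_); congr 1; omega
  -- `b ≠ 0`
  have hb0 : gβ - gα ≠ 0 := by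
    intro h
    rw [h, map_zero, mul_zero] at hfar
    exact absurd hfar (not_le.2 (mul_pos (pow_pos hvϖ0 _) hvG))
  have hvb : 0 < Valued.v (gβ - gα) := (Valuation.pos_iff _).2 hb0
  -- `t = (1 − c′)G∕b`, `|t| ≤ |ϖ|^ρ`
  obtain ⟨s, hs⟩ : ∃ s : K, s = (1 - c') * (f * gα + gβ) / (gβ - gα) := ⟨_, rfl⟩
  have hσs : σ s = s := by rw [hs, map_div₀, map_mul, map_sub, map_one, hσc', map_add, map_mul, hσf, hσgα, map_sub, hσgβ, hσgα]
  have hvs : Valued.v s ≤ Valued.v ϖ ^ ρ := by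
    rw [hs, map_div₀, map_mul, div_le_iff₀ hvb]
    exact (mul_le_mul' hcd' le_rfl).trans hfar
  obtain ⟨u, hu, hu0, hu1, hu2⟩ := exists_mem_fixedUnitStabilizer_updown hϖ hρ hx hζ hσf hf V hV hσs hvs
  refine ⟨u, hu, ?_⟩
  -- `L♭(u_t) = G·c′`
  have hL : (1 + f) * gα * ((u 2 : Kˣ) : K) + (gβ - gα) * ((u 1 : Kˣ) : K) = (f * gα + gβ) * c' := by
    rw [hu2, hu1, hs]; field_simp; ring
  have hσG : σ (f * gα + gβ) = f * gα + gβ := by rw [map_add, map_mul, hσf, hσgα, hσgβ]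
  have hc'0 : c' ≠ 0 := fun h => by rw [h, map_zero] at hc'1; exact zero_ne_one hc'1
  rw [hL, hu2, normSign_mul_of_fixed hD hσG hσc' hG0 hc'0, normSign_of_not_isNorm σ hc'n, F0P3cDyRamLabelledOddOneSlotRead.normSign_one_eq σ]
  have hG := F0P3cDyRamDiagonalKappaSplitCountEval.normSign_mul_self σ (f * gα + gβ)
  linear_combination (-1 : ℤ) * hG

/-- **SLOT 1, DEAD WINDOW `ρ ≤ 2d − 2`: some `u ∈ S_F` has `ω(u₁)·θ(u) = −1`** — `u = u_t`, `t = (1 − c′)G∕(G + g_β − g_α)` (`|t| ≤ |ϖ|^{2d−2} ≤ |ϖ|^ρ` as `|G + g_β − g_α| = |G|`;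
`(1 − t)·L♭(u_t) = G·c′ + (g_β − g_α)t²`, and `|t²| ≤ |ϖ|^{4d−4} ≤ |ϖ|^{2d−1}`). [cite: Serre1979, Ch. V §3 Prop. 5, Cor. 2–3 pp. 84–86; Ch. XV §2] [cite: Kottwitz1986BaseChangeUnits, §1 pp. 240–241] -/
theorem exists_normSign_one_mul_theta_eq_neg_one (hD : IsRamifiedQuadraticDatum σ ϖ d t) (h2 : Valued.v (2 : K) < 1)
    {ρ : ℕ} (hρ : 1 ≤ ρ) (hdead : ρ ≤ 2 * d - 2) {x ζ f : K} (hx : Valued.v x = 1) (hζ : Valued.v ζ = 1) (hσf : σ f = f) (hf : Valued.v f = 1)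
    (V : GL (Fin 3) K) (hV : (V : Matrix (Fin 3) (Fin 3) K) = !![1, 0, 0; x, ϖ ^ ρ, 0; x * ζ + f * (x * ζ), ϖ ^ ρ * ζ, ϖ ^ (2 * ρ)])
    {gα gβ : K} (hσgα : σ gα = gα) (hσgβ : σ gβ = gβ) (hG0 : f * gα + gβ ≠ 0) (hb : Valued.v (gβ - gα) ≤ Valued.v (f * gα + gβ))
    (hGb : Valued.v (f * gα + gβ + (gβ - gα)) = Valued.v (f * gα + gβ)) :
    ∃ u ∈ fixedUnitStabilizer σ (latt (V : Matrix (Fin 3) (Fin 3) K)),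
      normSign σ ((u 1 : Kˣ) : K) * (normSign σ (f * gα + gβ) * normSign σ ((1 + f) * gα * ((u 2 : Kˣ) : K) + (gβ - gα) * ((u 1 : Kˣ) : K))) = -1 := by
  obtain ⟨hσ, hvσ, hϖ, hfix, hdd, hd1, -⟩ := id hD
  have hϖ0 : ϖ ≠ 0 := fun h => by rw [h, map_zero] at hϖ; exact (exp_ne_zero hϖ.symm).elim
  have hϖ1 : Valued.v ϖ < 1 := by rw [hϖ, ← exp_zero, exp_lt_exp]; norm_num
  have hd2 : 2 ≤ d := two_le_d_of_v_two_lt_one hD h2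
  have hvG : 0 < Valued.v (f * gα + gβ) := (Valuation.pos_iff _).2 hG0
  have hGb0 : f * gα + gβ + (gβ - gα) ≠ 0 := fun h => by rw [h, map_zero] at hGb; exact hvG.ne' hGb.symm
  -- the break non-norm
  obtain ⟨c', hσc', hc'1, hc'd, hc'n⟩ := exists_fixed_unit_not_norm_v_sub_one_le hD h2
  have hcd' : Valued.v (1 - c') ≤ Valued.v ϖ ^ (2 * d - 2) := by
    rw [← neg_sub, Valuation.map_neg, v_varpi_pow hϖ]; refine hc'd.trans (le_of_eq ?_); congr 1; omega
  have hc'0 : c' ≠ 0 := fun h => by rw [h, map_zero] at hc'1; exact zero_ne_one hc'1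
  -- `t = (1 − c′)G∕(G + b)`, `|t| = |1 − c′| ≤ |ϖ|^{2d−2} ≤ |ϖ|^ρ`
  obtain ⟨s, hs⟩ : ∃ s : K, s = (1 - c') * (f * gα + gβ) / (f * gα + gβ + (gβ - gα)) := ⟨_, rfl⟩
  have hσs : σ s = s := by
    rw [hs]; simp only [map_div₀, map_mul, map_sub, map_add, map_one, hσc', hσf, hσgα, hσgβ]
  have hvs' : Valued.v s = Valued.v (1 - c') := by
    rw [hs, map_div₀, map_mul, hGb, mul_div_assoc, div_self hvG.ne', mul_one]
  have hvs2 : Valued.v s ≤ Valued.v ϖ ^ (2 * d - 2) := by rw [hvs']; exact hcd'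
  have hvs : Valued.v s ≤ Valued.v ϖ ^ ρ := hvs2.trans (pow_le_pow_right_of_le_one' hϖ1.le hdead)
  obtain ⟨u, hu, hu0, hu1, hu2⟩ := exists_mem_fixedUnitStabilizer_updown hϖ hρ hx hζ hσf hf V hV hσs hvs
  refine ⟨u, hu, ?_⟩
  obtain ⟨hvL, hL0⟩ := v_reduced_eq (σ := σ) hϖ hρ hx hζ hf V hV hG0 hb hu
  have hufix : ∀ j, σ ((u j : Kˣ) : K) = u j := fun j => ((mem_fixedUnitTorus_iff σ u).1 hu.2).2 j
  have hσL : σ ((1 + f) * gα * ((u 2 : Kˣ) : K) + (gβ - gα) * ((u 1 : Kˣ) : K)) = (1 + f) * gα * ((u 2 : Kˣ) : K) + (gβ - gα) * ((u 1 : Kˣ) : K) := by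
    simp only [map_add, map_mul, map_sub, map_one, hσf, hσgα, hσgβ, hufix]
  have hσG : σ (f * gα + gβ) = f * gα + gβ := by rw [map_add, map_mul, hσf, hσgα, hσgβ]
  -- `(1 − t)·L♭(u_t) = G c′ · y`, `y = 1 + b t²∕(G c′)`, `|y − 1| ≤ |ϖ|^{2d−1}`
  have hGc0 : (f * gα + gβ) * c' ≠ 0 := mul_ne_zero hG0 hc'0
  have hprod : ((u 1 : Kˣ) : K) * ((1 + f) * gα * ((u 2 : Kˣ) : K) + (gβ - gα) * ((u 1 : Kˣ) : K)) = (f * gα + gβ) * c' + (gβ - gα) * s ^ 2 := by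
    rw [hu1, hu2, hs]; field_simp; ring
  obtain ⟨y, hy⟩ : ∃ y : K, y = 1 + (gβ - gα) * s ^ 2 / ((f * gα + gβ) * c') := ⟨_, rfl⟩
  have hσy : σ y = y := by rw [hy]; simp only [map_add, map_one, map_div₀, map_mul, map_pow, map_sub, hσgβ, hσgα, hσs, hσf, hσc']
  have hy1 : Valued.v (y - 1) ≤ Valued.v ϖ ^ (2 * d - 1) := by
    rw [hy, add_sub_cancel_left, map_div₀, map_mul, map_mul, hc'1, mul_one, div_le_iff₀ hvG, map_pow]
    calc Valued.v (gβ - gα) * Valued.v s ^ 2 ≤ Valued.v (f * gα + gβ) * (Valued.v ϖ ^ (2 * d - 2)) ^ 2 :=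
          mul_le_mul' hb (pow_le_pow_left₀ zero_le hvs2 2)
      _ = Valued.v ϖ ^ (2 * (2 * d - 2)) * Valued.v (f * gα + gβ) := by rw [← pow_mul]; ac_rfl
      _ ≤ Valued.v ϖ ^ (2 * d - 1) * Valued.v (f * gα + gβ) := mul_le_mul' (pow_le_pow_right_of_le_one' hϖ1.le (by omega)) le_rfl
  have hfac : ((u 1 : Kˣ) : K) * ((1 + f) * gα * ((u 2 : Kˣ) : K) + (gβ - gα) * ((u 1 : Kˣ) : K)) = ((f * gα + gβ) * c') * y := by
    rw [hprod, hy, mul_add, mul_one, mul_div_cancel₀ _ hGc0]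
  have hω : normSign σ ((u 1 : Kˣ) : K) * normSign σ ((1 + f) * gα * ((u 2 : Kˣ) : K) + (gβ - gα) * ((u 1 : Kˣ) : K)) = -normSign σ (f * gα + gβ) := by
    rw [← normSign_mul_of_fixed hD (hufix 1) hσL (u 1).ne_zero hL0, hfac, normSign_mul_eq_of_fixed_of_v_sub_one_le hD _ hσy le_rfl hy1,
      normSign_mul_of_fixed hD hσG hσc' hG0 hc'0, normSign_of_not_isNorm σ hc'n, mul_neg_one]
  have hG := F0P3cDyRamDiagonalKappaSplitCountEval.normSign_mul_self σ (f * gα + gβ)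
  linear_combination (normSign σ (f * gα + gβ)) * hω - hG

/-- **SLOT 0, DEAD WINDOW `ρ ≤ 2d − 2`: some `u ∈ S_F` has `ω(u₀)·θ(u) = −1`** — `u = u_t`, `t = (c′ − 1)G·f∕(G − f(g_β − g_α))` (`|t| = |1 − c′|` as `|G − f(g_β − g_α)| = |G|`;
`(1 + t∕f)·L♭(u_t) = G·c′ − (g_β − g_α)t²∕f`). [cite: Serre1979, Ch. V §3 Prop. 5, Cor. 2–3 pp. 84–86; Ch. XV §2] [cite: Kottwitz1986BaseChangeUnits, §1 pp. 240–241] -/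
theorem exists_normSign_zero_mul_theta_eq_neg_one (hD : IsRamifiedQuadraticDatum σ ϖ d t) (h2 : Valued.v (2 : K) < 1)
    {ρ : ℕ} (hρ : 1 ≤ ρ) (hdead : ρ ≤ 2 * d - 2) {x ζ f : K} (hx : Valued.v x = 1) (hζ : Valued.v ζ = 1) (hσf : σ f = f) (hf : Valued.v f = 1)
    (V : GL (Fin 3) K) (hV : (V : Matrix (Fin 3) (Fin 3) K) = !![1, 0, 0; x, ϖ ^ ρ, 0; x * ζ + f * (x * ζ), ϖ ^ ρ * ζ, ϖ ^ (2 * ρ)])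
    {gα gβ : K} (hσgα : σ gα = gα) (hσgβ : σ gβ = gβ) (hG0 : f * gα + gβ ≠ 0) (hb : Valued.v (gβ - gα) ≤ Valued.v (f * gα + gβ))
    (hGfb : Valued.v (f * gα + gβ - f * (gβ - gα)) = Valued.v (f * gα + gβ)) :
    ∃ u ∈ fixedUnitStabilizer σ (latt (V : Matrix (Fin 3) (Fin 3) K)),
      normSign σ ((u 0 : Kˣ) : K) * (normSign σ (f * gα + gβ) * normSign σ ((1 + f) * gα * ((u 2 : Kˣ) : K) + (gβ - gα) * ((u 1 : Kˣ) : K))) = -1 := by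
  obtain ⟨hσ, hvσ, hϖ, hfix, hdd, hd1, -⟩ := id hD
  have hϖ0 : ϖ ≠ 0 := fun h => by rw [h, map_zero] at hϖ; exact (exp_ne_zero hϖ.symm).elim
  have hϖ1 : Valued.v ϖ < 1 := by rw [hϖ, ← exp_zero, exp_lt_exp]; norm_num
  have hd2 : 2 ≤ d := two_le_d_of_v_two_lt_one hD h2
  have hf0 : f ≠ 0 := fun h => by rw [h, map_zero] at hf; exact zero_ne_one hf
  have hvG : 0 < Valued.v (f * gα + gβ) := (Valuation.pos_iff _).2 hG0
  have hD0 : f * gα + gβ - f * (gβ - gα) ≠ 0 := fun h => by rw [h, map_zero] at hGfb; exact hvG.ne' hGfb.symm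
  -- the break non-norm
  obtain ⟨c', hσc', hc'1, hc'd, hc'n⟩ := exists_fixed_unit_not_norm_v_sub_one_le hD h2
  have hcd' : Valued.v (c' - 1) ≤ Valued.v ϖ ^ (2 * d - 2) := by
    rw [v_varpi_pow hϖ]; refine hc'd.trans (le_of_eq ?_); congr 1; omega
  have hc'0 : c' ≠ 0 := fun h => by rw [h, map_zero] at hc'1; exact zero_ne_one hc'1
  -- `t = (c′ − 1)·G·f∕(G − f b)`, `|t| = |c′ − 1| ≤ |ϖ|^{2d−2} ≤ |ϖ|^ρ`
  obtain ⟨s, hs⟩ : ∃ s : K, s = (c' - 1) * (f * gα + gβ) * f / (f * gα + gβ - f * (gβ - gα)) := ⟨_, rfl⟩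
  have hσs : σ s = s := by
    rw [hs]; simp only [map_div₀, map_mul, map_sub, map_add, map_one, hσc', hσf, hσgα, hσgβ]
  have hvs' : Valued.v s = Valued.v (c' - 1) := by
    rw [hs, map_div₀, map_mul, map_mul, hf, mul_one, hGfb, mul_div_assoc, div_self hvG.ne', mul_one]
  have hvs2 : Valued.v s ≤ Valued.v ϖ ^ (2 * d - 2) := by rw [hvs']; exact hcd'
  have hvs : Valued.v s ≤ Valued.v ϖ ^ ρ := hvs2.trans (pow_le_pow_right_of_le_one' hϖ1.le hdead)
  obtain ⟨u, hu, hu0, hu1, hu2⟩ := exists_mem_fixedUnitStabilizer_updown hϖ hρ hx hζ hσf hf V hV hσs hvs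
  refine ⟨u, hu, ?_⟩
  obtain ⟨hvL, hL0⟩ := v_reduced_eq (σ := σ) hϖ hρ hx hζ hf V hV hG0 hb hu
  have hufix : ∀ j, σ ((u j : Kˣ) : K) = u j := fun j => ((mem_fixedUnitTorus_iff σ u).1 hu.2).2 j
  have hσL : σ ((1 + f) * gα * ((u 2 : Kˣ) : K) + (gβ - gα) * ((u 1 : Kˣ) : K)) = (1 + f) * gα * ((u 2 : Kˣ) : K) + (gβ - gα) * ((u 1 : Kˣ) : K) := by
    simp only [map_add, map_mul, map_sub, map_one, hσf, hσgα, hσgβ, hufix]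
  have hσG : σ (f * gα + gβ) = f * gα + gβ := by rw [map_add, map_mul, hσf, hσgα, hσgβ]
  -- `(1 + t∕f)·L♭(u_t) = G c′ · y`, `y = 1 − b t²∕(f G c′)`
  have hGc0 : (f * gα + gβ) * c' ≠ 0 := mul_ne_zero hG0 hc'0
  have hprod : ((u 0 : Kˣ) : K) * ((1 + f) * gα * ((u 2 : Kˣ) : K) + (gβ - gα) * ((u 1 : Kˣ) : K)) = (f * gα + gβ) * c' - (gβ - gα) * s ^ 2 / f := by
    rw [hu0, hu1, hu2, hs]; field_simp; ring
  obtain ⟨y, hy⟩ : ∃ y : K, y = 1 - (gβ - gα) * s ^ 2 / f / ((f * gα + gβ) * c') := ⟨_, rfl⟩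
  have hσy : σ y = y := by rw [hy]; simp only [map_sub, map_add, map_one, map_div₀, map_mul, map_pow, hσgβ, hσgα, hσs, hσf, hσc']
  have hy1 : Valued.v (y - 1) ≤ Valued.v ϖ ^ (2 * d - 1) := by
    rw [hy, sub_sub_cancel_left, Valuation.map_neg, map_div₀, map_div₀, map_mul, map_mul, hc'1, hf, mul_one, div_one, div_le_iff₀ hvG, map_pow]
    calc Valued.v (gβ - gα) * Valued.v s ^ 2 ≤ Valued.v (f * gα + gβ) * (Valued.v ϖ ^ (2 * d - 2)) ^ 2 :=
          mul_le_mul' hb (pow_le_pow_left₀ zero_le hvs2 2)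
      _ = Valued.v ϖ ^ (2 * (2 * d - 2)) * Valued.v (f * gα + gβ) := by rw [← pow_mul]; ac_rfl
      _ ≤ Valued.v ϖ ^ (2 * d - 1) * Valued.v (f * gα + gβ) := mul_le_mul' (pow_le_pow_right_of_le_one' hϖ1.le (by omega)) le_rfl
  have hfac : ((u 0 : Kˣ) : K) * ((1 + f) * gα * ((u 2 : Kˣ) : K) + (gβ - gα) * ((u 1 : Kˣ) : K)) = ((f * gα + gβ) * c') * y := by
    rw [hprod, hy, mul_sub, mul_one, mul_div_cancel₀ _ hGc0]
  have hω : normSign σ ((u 0 : Kˣ) : K) * normSign σ ((1 + f) * gα * ((u 2 : Kˣ) : K) + (gβ - gα) * ((u 1 : Kˣ) : K)) = -normSign σ (f * gα + gβ) := by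
    rw [← normSign_mul_of_fixed hD (hufix 0) hσL (u 0).ne_zero hL0, hfac, normSign_mul_eq_of_fixed_of_v_sub_one_le hD _ hσy le_rfl hy1,
      normSign_mul_of_fixed hD hσG hσc' hG0 hc'0, normSign_of_not_isNorm σ hc'n, mul_neg_one]
  have hG := F0P3cDyRamDiagonalKappaSplitCountEval.normSign_mul_self σ (f * gα + gβ)
  linear_combination (normSign σ (f * gα + gβ)) * hω - hG

end Witness

end Summit.HodgeConjecture.HodgeConjecture.Cruxes.H413.F0P3cDyRamLabelledOddCoreHangingCharacterWindows

end
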